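import Summits.BirchSwinnertonDyer.BirchSwinnertonDyer.Theorems.EisensteinPrimesBSDpOnCellCRetractionSpecializationTorsion
import Summits.BirchSwinnertonDyer.BirchSwinnertonDyer.Theorems.SignedLowerHalvesSmallImageLowerHalfBothSignsRttD2LambdaSpecialisation
import Literature.NumberTheory.IwasawaTheory.IwasawaAlgebraTwoVarRegularProofs
import HarnessLib

/-!
# Route `SignedLowerHalves`, crux L `SmallImageLowerHalfBothSigns` (item stmt-BirchSwinnertonDyer-23599), line `rtt_w3` v13 — E2,
# row **D2-λspec**, part 2: the specialisation lemma WITH `𝒪`-COEFFICIENTS — along the inner evaluation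
# `φ_b : 𝒪⟦T₂⟧⟦T₁⟧ ↠ 𝒪⟦T₁⟧` at `b ∈ 𝔪_𝒪` (`f = T₂ − b = C (X − C b)`; `…RttCharRoadE2TwistSpecialisation.exists_innerEval`), for ANY
# discrete valuation ring `𝒪`: `char_{𝒪⟦T⟧}(N/fN) = char_{𝒪⟦T⟧}(N[f]) · (φ_b g)` for f.g. torsion `N` with `char_{𝒪⟦T₂⟧⟦T₁⟧} N = (g)`, `φ_b g ≠ 0`

Width seat `bsd-line-slh-p3-w3` g19 under LEAD `cruxlead-stmt-BirchSwinnertonDyer-23599` g9 (cell `bsd-ssimc`); ROUTE-INDEPENDENT helper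
(`--supports stmt-BirchSwinnertonDyer-23599`); THEOREMS ONLY — no definition, no named fact, no instance, no `sorry`; pure commutative algebra;
closes nothing; BSD is not proved by any of this. Sequel of `…RttD2LambdaSpecialisation` (p775239: the case `𝒪 = ℤ_p` with the λ-reading).

WHY. E2 is research content exactly when the partner Grössencharakter `ψ` is NOT `K`-valued (BRIEF-E2 §1), i.e. when the coefficient ring
`𝒪 = 𝒪_{ℚ_p(S)}` of `θ` is bigger than `ℤ_p`; road D then runs over `Λ_{𝒪,2} = 𝒪⟦T₂⟧⟦T₁⟧` (row D2-O: the `𝒪`-twin `cor53_thm52ShapeO` of JLK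
Cor. 5.3) and specialises along `φ_b` (the LEAD's `exists_innerEval` is already stated for every `𝔪`-adically complete local `A`). The
specialisation lemma itself needs no completeness and no `p`: for ANY discrete valuation ring `𝒪`, `𝒪⟦T⟧` is factorial (Mathlib, `𝒪` a PID)
and so is `𝒪⟦T₂⟧⟦T₁⟧` (tree `IwasawaTheory.uniqueFactorizationMonoid_powerSeries_powerSeries`, Auslander–Buchsbaum), so crux-4 cell C's
retraction Herbrand formula `RetractionSpecialization.charIdeal_quotSMulTop_eq_mul_of_retraction` applies verbatim once `φ_b` is known to be a
retraction of the outer embedding `ι = PowerSeries.map C : 𝒪⟦T⟧ → 𝒪⟦T₂⟧⟦T₁⟧` — which follows from the clauses `φ (C (C a)) = C a`, `φ X = X`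
alone by part 1's rigidity `ringHom_eq_id_of_map_C_of_map_X`. The `Λ_𝒪 = 𝒪⟦T⟧`-structures are EXPLICIT restriction of scalars along `ι`
(`Module.compHom _ ι`, «`T` acts as `T₁`»). The λ-reading over `𝒪` (currency `dim_K(K ⊗_𝒪 ·)` / `lamO`) is then RTT@2's H-λchar
(`…CharIdealLambda.finrank_baseChange_eq_of_span_C_mul_charIdeal_eq`) — not repeated here.

* §1 `map_outer_eq_self_of_clauses'` (`φ (PowerSeries.map C a) = a`, any comm ring); `C_X_sub_C_C_ne_zero` (`f ≠ 0`).
* §2 ★★ **`charIdeal_quotSMulTop_eq_mul_of_innerEval`** (the `𝒪`-coefficient `SpecialisationShape` along `f = C (X − C b)`), with the fibre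
  `N/fN` and kernel `N[f]` finitely generated and torsion over `𝒪⟦T⟧` (`finite_isTorsion_quotSMulTop_torsionBy_of_innerEval`);
  ★ **`charIdeal_quotSMulTop_mul_eq_of_charIdeal_eq`** — ROAD D: `char A = char B = (g)`, `φ g ≠ 0` ⟹
  `char(A/fA)·char(B[f]) = char(B/fB)·char(A[f])` as ideals of `𝒪⟦T⟧`.

References: [BourbakiAC5to7] VII §4.5; [SkinnerUrban2014] §3.1.6, Cor. 3.2.9; [Ochiai2006] Lemma 7.2; [Matsumura1987] Thm. 20.3;
[JohnsonLeungKings2011] §4.2, Cor. 5.3.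
-/

set_option autoImplicit false
-- the Theorems namespace of this sub repeats the summit name by design (D-0017 nested layout)
set_option linter.dupNamespace false

noncomputable section

open PowerSeries Literature.NumberTheory.EllipticCurves Literature.NumberTheory.EllipticCurves.Module
open Summit.BirchSwinnertonDyer.BirchSwinnertonDyer.Theorems.RetractionSpecialization

namespace Summit.BirchSwinnertonDyer.BirchSwinnertonDyer.Theorems.SmallImageRttD2LamSpec

universe u v

/-! ## §1. The inner evaluation is a retraction of the outer embedding; `f ≠ 0` -/

/-- `φ (PowerSeries.map C a) = a` for every `a ∈ A⟦T⟧`, from the clauses `φ (C (C a)) = C a` and `φ X = X` of `exists_innerEval` (rigidity of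
§1 of part 1). [folklore] -/
theorem map_outer_eq_self_of_clauses' {A : Type u} [CommRing A] (φ : PowerSeries (PowerSeries A) →+* PowerSeries A)
    (hC : ∀ a : A, φ (C (C a)) = C a) (hX : φ X = X) (a : PowerSeries A) :
    φ (PowerSeries.map (PowerSeries.C : A →+* PowerSeries A) a) = a := by
  have h := ringHom_eq_id_of_map_C_of_map_X (φ.comp (PowerSeries.map (PowerSeries.C : A →+* PowerSeries A)))
    (fun c ↦ by rw [RingHom.comp_apply, map_C, hC]) (by rw [RingHom.comp_apply, map_X, hX])
  exact DFunLike.congr_fun h a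

/-- `f = C (X − C b) ≠ 0` in `A⟦X⟧⟦T⟧` (`A` non-trivial). [folklore] -/
theorem C_X_sub_C_C_ne_zero {A : Type u} [CommRing A] [Nontrivial A] (b : A) :
    (C (X - C b) : PowerSeries (PowerSeries A)) ≠ 0 := by
  intro h
  have h1 := congrArg (fun g : PowerSeries (PowerSeries A) ↦ coeff 1 (constantCoeff g)) h
  simp only [constantCoeff_C, map_sub, coeff_one_X, coeff_C, one_ne_zero, if_false, sub_zero, map_zero] at h1

/-! ## §2. The specialisation lemma along `f = C (X − C b)` over a discrete valuation ring -/

section DVR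

variable {A : Type u} [CommRing A] [IsDomain A] [IsDiscreteValuationRing A] (b : A)
  (φ : PowerSeries (PowerSeries A) →+* PowerSeries A)
  (hφf : φ (C (X - C b)) = 0) (hC : ∀ a : A, φ (C (C a)) = C a) (hX : φ X = X)
  (hker : RingHom.ker φ = Ideal.span {C (X - C b)})

omit [IsDomain A] [IsDiscreteValuationRing A] in
include hker in
/-- `ker φ = (f)` in divisibility form. [folklore] -/
theorem dvd_of_map_eq_zero' (g : PowerSeries (PowerSeries A)) (hg : φ g = 0) : C (X - C b) ∣ g := by
  rw [← Ideal.mem_span_singleton, ← hker]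
  exact hg

include hφf hC hX hker in
/-- ★★ **Specialisation of characteristic ideals along the inner evaluation `φ_b : 𝒪⟦T₂⟧⟦T₁⟧ ↠ 𝒪⟦T₁⟧` (`𝒪` a DVR), with the torsion correction.**
For `N` finitely generated over `𝒪⟦T₂⟧⟦T₁⟧`, killed by some `t ≠ 0`, with `char N = (g)`, `φ g ≠ 0`, and the `𝒪⟦T⟧`-structure on `N` the restriction along
`ι = PowerSeries.map C` (explicit): `char_{𝒪⟦T⟧}(N/fN) = char_{𝒪⟦T⟧}(N[f]) · (φ g)`, `f = C (X − C b)`. (Instance of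
`RetractionSpecialization.charIdeal_quotSMulTop_eq_mul_of_retraction`; factoriality of `𝒪⟦T₂⟧⟦T₁⟧` from the tree, of `𝒪⟦T⟧` from Mathlib.)
[cite: BourbakiAC5to7, VII §4.5] [cite: SkinnerUrban2014, §3.1.6, Cor. 3.2.9] [cite: Matsumura1987, Thm. 20.3] -/
theorem charIdeal_quotSMulTop_eq_mul_of_innerEval (N : Type v) [AddCommGroup N] [Module (PowerSeries (PowerSeries A)) N]
    [Module.Finite (PowerSeries (PowerSeries A)) N] {t : PowerSeries (PowerSeries A)} (ht0 : t ≠ 0) (ht : ∀ n : N, t • n = 0)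
    {g : PowerSeries (PowerSeries A)} (hg : charIdeal (PowerSeries (PowerSeries A)) N = Ideal.span {g}) (hg0 : φ g ≠ 0) :
    letI : Algebra (PowerSeries A) (PowerSeries (PowerSeries A)) := (PowerSeries.map (PowerSeries.C : A →+* PowerSeries A)).toAlgebra
    letI : Module (PowerSeries A) N := Module.compHom N (PowerSeries.map (PowerSeries.C : A →+* PowerSeries A))
    haveI : IsScalarTower (PowerSeries A) (PowerSeries (PowerSeries A)) N := IsScalarTower.of_algebraMap_smul fun _ _ ↦ rfl
    charIdeal (PowerSeries A) (QuotSMulTop (C (X - C b) : PowerSeries (PowerSeries A)) N) =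
      charIdeal (PowerSeries A) (Submodule.torsionBy (PowerSeries (PowerSeries A)) N (C (X - C b))) * Ideal.span {φ g} := by
  letI : Algebra (PowerSeries A) (PowerSeries (PowerSeries A)) := (PowerSeries.map (PowerSeries.C : A →+* PowerSeries A)).toAlgebra
  letI : Module (PowerSeries A) N := Module.compHom N (PowerSeries.map (PowerSeries.C : A →+* PowerSeries A))
  haveI : IsScalarTower (PowerSeries A) (PowerSeries (PowerSeries A)) N := IsScalarTower.of_algebraMap_smul fun _ _ ↦ rfl
  haveI : UniqueFactorizationMonoid (PowerSeries (PowerSeries A)) :=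
    Literature.NumberTheory.IwasawaTheory.uniqueFactorizationMonoid_powerSeries_powerSeries A
  have hret : ∀ a : PowerSeries A, φ (algebraMap (PowerSeries A) (PowerSeries (PowerSeries A)) a) = a :=
    map_outer_eq_self_of_clauses' φ hC hX
  have hker' : ∀ c : PowerSeries (PowerSeries A), φ c = 0 → C (X - C b) ∣ c := dvd_of_map_eq_zero' b φ hker
  have hf0 : (C (X - C b) : PowerSeries (PowerSeries A)) ≠ 0 := C_X_sub_C_C_ne_zero b
  have hfg : ¬ (C (X - C b) : PowerSeries (PowerSeries A)) ∣ g := fun h ↦ by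
    obtain ⟨c, rfl⟩ := h
    exact hg0 (by rw [map_mul, hφf, zero_mul])
  obtain ⟨s, hfs, hs⟩ := exists_not_dvd_smul_eq_zero_of_not_dvd (N := N) hφf hker' hf0 ht0 ht hg hfg
  have hs0 : φ s ≠ 0 := fun h ↦ hfs (hker' s h)
  have H := charIdeal_quotSMulTop_eq_mul_of_retraction hret hφf hker' hf0 N ⟨s, hs0, hs⟩
  rw [hg, Ideal.map_span, Set.image_singleton] at H
  exact H

include hφf hC hX hker in
/-- The fibre `N/fN` and the kernel `N[f]` are finitely generated TORSION `𝒪⟦T⟧`-modules (structures along `ι`), under the hypotheses of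
`charIdeal_quotSMulTop_eq_mul_of_innerEval` — so their characteristic ideals and `λ_𝒪`-invariants are honest. [folklore] -/
theorem finite_isTorsion_quotSMulTop_torsionBy_of_innerEval (N : Type v) [AddCommGroup N] [Module (PowerSeries (PowerSeries A)) N]
    [Module.Finite (PowerSeries (PowerSeries A)) N] {t : PowerSeries (PowerSeries A)} (ht0 : t ≠ 0) (ht : ∀ n : N, t • n = 0)
    {g : PowerSeries (PowerSeries A)} (hg : charIdeal (PowerSeries (PowerSeries A)) N = Ideal.span {g}) (hg0 : φ g ≠ 0) :
    letI : Algebra (PowerSeries A) (PowerSeries (PowerSeries A)) := (PowerSeries.map (PowerSeries.C : A →+* PowerSeries A)).toAlgebra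
    letI : Module (PowerSeries A) N := Module.compHom N (PowerSeries.map (PowerSeries.C : A →+* PowerSeries A))
    haveI : IsScalarTower (PowerSeries A) (PowerSeries (PowerSeries A)) N := IsScalarTower.of_algebraMap_smul fun _ _ ↦ rfl
    Module.Finite (PowerSeries A) (QuotSMulTop (C (X - C b) : PowerSeries (PowerSeries A)) N) ∧
      Module.IsTorsion (PowerSeries A) (QuotSMulTop (C (X - C b) : PowerSeries (PowerSeries A)) N) ∧
      Module.Finite (PowerSeries A) (Submodule.torsionBy (PowerSeries (PowerSeries A)) N (C (X - C b))) ∧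
      Module.IsTorsion (PowerSeries A) (Submodule.torsionBy (PowerSeries (PowerSeries A)) N (C (X - C b))) := by
  letI : Algebra (PowerSeries A) (PowerSeries (PowerSeries A)) := (PowerSeries.map (PowerSeries.C : A →+* PowerSeries A)).toAlgebra
  letI : Module (PowerSeries A) N := Module.compHom N (PowerSeries.map (PowerSeries.C : A →+* PowerSeries A))
  haveI : IsScalarTower (PowerSeries A) (PowerSeries (PowerSeries A)) N := IsScalarTower.of_algebraMap_smul fun _ _ ↦ rfl
  have hret : ∀ a : PowerSeries A, φ (algebraMap (PowerSeries A) (PowerSeries (PowerSeries A)) a) = a :=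
    map_outer_eq_self_of_clauses' φ hC hX
  have hker' : ∀ c : PowerSeries (PowerSeries A), φ c = 0 → C (X - C b) ∣ c := dvd_of_map_eq_zero' b φ hker
  have hf0 : (C (X - C b) : PowerSeries (PowerSeries A)) ≠ 0 := C_X_sub_C_C_ne_zero b
  have hfg : ¬ (C (X - C b) : PowerSeries (PowerSeries A)) ∣ g := fun h ↦ by
    obtain ⟨c, rfl⟩ := h
    exact hg0 (by rw [map_mul, hφf, zero_mul])
  obtain ⟨s, hfs, hs⟩ := exists_not_dvd_smul_eq_zero_of_not_dvd (N := N) hφf hker' hf0 ht0 ht hg hfg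
  have hs0 : φ s ≠ 0 := fun h ↦ hfs (hker' s h)
  obtain ⟨hQs, hKs⟩ := isTorsionBy_map_of_retraction' (N := N) (π := (C (X - C b) : PowerSeries (PowerSeries A))) hret hker' hs
  have hs0' : φ s ∈ nonZeroDivisors (PowerSeries A) := mem_nonZeroDivisors_of_ne_zero hs0
  refine ⟨moduleFinite_quotSMulTop_of_retraction hret hker', ?_, moduleFinite_torsionBy_of_retraction hret hker', ?_⟩
  · intro x; exact ⟨⟨φ s, hs0'⟩, @hQs x⟩
  · intro x; exact ⟨⟨φ s, hs0'⟩, @hKs x⟩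

include hφf hC hX hker in
/-- ★ **Road D's use, `𝒪`-coefficients, characteristic-ideal currency.** If `char A = char B = (g)` (the `𝒪`-twin of JLK Cor. 5.3) with `φ g ≠ 0`, then
along `f = C (X − C b)`: `char(A/fA) · char(B[f]) = char(B/fB) · char(A[f])` as ideals of `𝒪⟦T⟧` — the specialised generator cancels; with the descent
sequences this is E2-K on the `θ`-line, and `λ_𝒪` is read off by RTT@2's H-λchar. [cite: JohnsonLeungKings2011, §4.2, Cor. 5.3] [cite: BourbakiAC5to7, VII §4.5] -/
theorem charIdeal_quotSMulTop_mul_eq_of_charIdeal_eq (M N : Type v) [AddCommGroup M] [Module (PowerSeries (PowerSeries A)) M]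
    [Module.Finite (PowerSeries (PowerSeries A)) M] [AddCommGroup N] [Module (PowerSeries (PowerSeries A)) N]
    [Module.Finite (PowerSeries (PowerSeries A)) N]
    {tM : PowerSeries (PowerSeries A)} (htM0 : tM ≠ 0) (htM : ∀ m : M, tM • m = 0)
    {tN : PowerSeries (PowerSeries A)} (htN0 : tN ≠ 0) (htN : ∀ n : N, tN • n = 0)
    {g : PowerSeries (PowerSeries A)} (hgM : charIdeal (PowerSeries (PowerSeries A)) M = Ideal.span {g})
    (hMN : charIdeal (PowerSeries (PowerSeries A)) M = charIdeal (PowerSeries (PowerSeries A)) N) (hg0 : φ g ≠ 0) :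
    letI : Algebra (PowerSeries A) (PowerSeries (PowerSeries A)) := (PowerSeries.map (PowerSeries.C : A →+* PowerSeries A)).toAlgebra
    letI : Module (PowerSeries A) M := Module.compHom M (PowerSeries.map (PowerSeries.C : A →+* PowerSeries A))
    letI : Module (PowerSeries A) N := Module.compHom N (PowerSeries.map (PowerSeries.C : A →+* PowerSeries A))
    haveI : IsScalarTower (PowerSeries A) (PowerSeries (PowerSeries A)) M := IsScalarTower.of_algebraMap_smul fun _ _ ↦ rfl
    haveI : IsScalarTower (PowerSeries A) (PowerSeries (PowerSeries A)) N := IsScalarTower.of_algebraMap_smul fun _ _ ↦ rfl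
    charIdeal (PowerSeries A) (QuotSMulTop (C (X - C b) : PowerSeries (PowerSeries A)) M) *
        charIdeal (PowerSeries A) (Submodule.torsionBy (PowerSeries (PowerSeries A)) N (C (X - C b))) =
      charIdeal (PowerSeries A) (QuotSMulTop (C (X - C b) : PowerSeries (PowerSeries A)) N) *
        charIdeal (PowerSeries A) (Submodule.torsionBy (PowerSeries (PowerSeries A)) M (C (X - C b))) := by
  have hM := charIdeal_quotSMulTop_eq_mul_of_innerEval b φ hφf hC hX hker M htM0 htM hgM hg0
  have hN := charIdeal_quotSMulTop_eq_mul_of_innerEval b φ hφf hC hX hker N htN0 htN (hMN ▸ hgM) hg0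
  rw [hM, hN]
  ring

end DVR

end Summit.BirchSwinnertonDyer.BirchSwinnertonDyer.Theorems.SmallImageRttD2LamSpec

end
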